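import Summits.ResolutionOfSingularities.ResolutionOfSingularities.Theorems.EquisingularLiftEquisingularLiftNatELNatAtQuadrics
import HarnessLib

/-!
# The honest residual of the route decls `EquisingularLiftNat` / `EquisingularLiftNatThree`, re-cut at degree `e ≥ 3`
# (quadrics discharged in every characteristic)

[OURS · leafhand-res-equisingularlift-6 g3, 2026-08-31; cell `pub/decomp-res`; items stmt-ResolutionOfSingularities-20038 / -20148] AI-produced, weaker
than expert review; NOT a statement of any manuscript; nothing here proves resolution of singularities.  DEF-FREE; no `sorry`; standard axioms; ZERO named
hypotheses; pure reduction over ✓ `QuadricELNat.elNatAt_quadric` (p820083) and ✓ `RouteCurrency.equisingularLiftNat(Three)_of_forall_elnatO_primeForms`.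

* `elnatO_quadric` — the stubs' currency `ELNatConclusionO k (n + 1) H ι` for every integral `H` and closed immersion `ι` with `range ι = V₊(F)`,
  `F` a prime quadratic form, every characteristic (✓ `elNatAt_quadric` + the bridge ✓ `RouteCurrency.elnatO_of_elNatAt`);
* ★ `equisingularLiftNat_of_forall_elnatO_primeForms_three_le` — `Theses.EquisingularLift.EquisingularLiftNat` (stmt-…-20038) holds BY NAME as soon
  as `ELNatConclusionO` is known for the NON-REGULAR integral `H` cut out by PRIME forms of degree `e ≥ 3` in `ℙⁿ_k`, `n ≥ 3` (was: `e ≥ 2`);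
* ★ `equisingularLiftNatThree_of_forall_elnatO_primeForms_three_le` — the same for `Theses.EquisingularLift.EquisingularLiftNatThree`
  (stmt-…-20148): non-regular integral SURFACES in `ℙ³` cut out by prime forms of degree `≥ 3`.

Honest reading: the residual starts at non-regular CUBIC surfaces in `ℙ³_k̄` (every `p`); no registered stub is closed.
-/

set_option linter.dupNamespace false -- mandated namespace `Summit.<Summit>.<Problem>` of this single-conjunct summit

noncomputable section

open CategoryTheory CategoryTheory.Limits AlgebraicGeometry TopologicalSpace
open MvPolynomial HomogeneousIdeal
open Literature.AlgebraicGeometry.Resolution Literature.AlgebraicGeometry.Motives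
open Summit.ResolutionOfSingularities.ResolutionOfSingularities.Theorems.EquisingularLift
open Summit.ResolutionOfSingularities.ResolutionOfSingularities.Cruxes.EquisingularLift.StrataSplit

namespace Summit.ResolutionOfSingularities.ResolutionOfSingularities.Cruxes.EquisingularLiftNat.Sections

namespace QuadricELNat

/-- **The stubs' currency for quadrics, every characteristic**: `ELNatConclusionO k (n + 1) H ι` for `H` integral, `ι` a closed immersion with
`range ι = V₊(F)`, `F` a prime quadratic form (✓ `elNatAt_quadric` + ✓ `RouteCurrency.elnatO_of_elNatAt`). [OURS · DEF-FREE]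
[cite: Hartshorne1977, I Ex. 5.12] -/
theorem elnatO_quadric (p : ℕ) (hp : p.Prime) (k : Type) [Field k] [CharP k p] [IsAlgClosed k] {n : ℕ}
    {H : Scheme.{0}} (ι : H ⟶ (projectiveSpace (n + 1) k).left) (hι : IsClosedImmersion ι) (hH : IsIntegral H)
    (F : MvPolynomial (Fin (n + 1 + 1)) k) (hF : F.IsHomogeneous 2) (hprime : Prime F)
    (hrange : letI := MvPolynomial.gradedAlgebra (σ := Fin (n + 1 + 1)) (R := k)
      Set.range ι = {x : Proj (homogeneousSubmodule (Fin (n + 1 + 1)) k) | F ∈ x.asHomogeneousIdeal}) :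
    ELNatConclusionO k (n + 1) H ι :=
  haveI := hι
  RouteCurrency.elnatO_of_elNatAt p hp k (n + 1) H ι hι hH (elNatAt_quadric p hp k ι F hF hprime hrange)

/-- ★ **`Theses.EquisingularLift.EquisingularLiftNat` (stmt-…-20038) from `ELNatConclusionO` at the NON-REGULAR PRIME-FORM HYPERSURFACES OF DEGREE
`≥ 3` IN `ℙⁿ`, `n ≥ 3`** — the residual of ✓ `RouteCurrency.equisingularLiftNat_of_forall_elnatO_primeForms` with the quadrics removed (✓ `elnatO_quadric`,
every characteristic). [OURS · DEF-FREE · pure reduction] [cite: Hartshorne1977, I Ex. 5.12] -/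
theorem equisingularLiftNat_of_forall_elnatO_primeForms_three_le
    (h : ∀ p : ℕ, p.Prime → ∀ (k : Type) [Field k] [CharP k p] [IsAlgClosed k] (n : ℕ) (H : Scheme.{0})
      (ι : H ⟶ (Literature.AlgebraicGeometry.Motives.projectiveSpace n k).left), IsClosedImmersion ι → IsIntegral H →
      (∀ y : (Literature.AlgebraicGeometry.Motives.projectiveSpace n k).left,
        ∃ U : (Literature.AlgebraicGeometry.Motives.projectiveSpace n k).left.affineOpens,
          y ∈ (U : (Literature.AlgebraicGeometry.Motives.projectiveSpace n k).left.Opens) ∧ (ι.ker.ideal U).IsPrincipal) →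
      3 ≤ n → ¬ Scheme.IsRegular H → ∀ (e : ℕ) (F : MvPolynomial (Fin (n + 1)) k), 3 ≤ e → F.IsHomogeneous e → Prime F →
      (letI := MvPolynomial.gradedAlgebra (σ := Fin (n + 1)) (R := k)
       Set.range ι = {x : Proj (homogeneousSubmodule (Fin (n + 1)) k) | F ∈ x.asHomogeneousIdeal}) →
      ELNatConclusionO k n H ι) :
    Summit.ResolutionOfSingularities.ResolutionOfSingularities.Theses.EquisingularLift.EquisingularLiftNat := by
  refine RouteCurrency.equisingularLiftNat_of_forall_elnatO_primeForms ?_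
  intro p hp k _ _ _ n H ι hι hH hloc hn hreg e F he hF hprime hrange
  by_cases he3 : 3 ≤ e
  · exact h p hp k n H ι hι hH hloc hn hreg e F he3 hF hprime hrange
  · have he2 : e = 2 := by omega
    subst he2
    obtain ⟨m, rfl⟩ : ∃ m, n = m + 1 := ⟨n - 1, by omega⟩
    exact elnatO_quadric p hp k ι hι hH F hF hprime hrange

/-- ★ **`Theses.EquisingularLift.EquisingularLiftNatThree` (stmt-…-20148) from `ELNatConclusionO` at the NON-REGULAR INTEGRAL SURFACES OF DEGREE `≥ 3`
IN `ℙ³`** — the residual of ✓ `RouteCurrency.equisingularLiftNatThree_of_forall_elnatO_primeForms` with the quadric surfaces removed (✓ `elnatO_quadric`,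
every characteristic; the only non-regular integral quadric surfaces are the cones over smooth conics). [OURS · DEF-FREE · pure reduction]
[cite: Hartshorne1977, I Ex. 5.12] -/
theorem equisingularLiftNatThree_of_forall_elnatO_primeForms_three_le
    (h : ∀ p : ℕ, p.Prime → ∀ (k : Type) [Field k] [CharP k p] [IsAlgClosed k] (n : ℕ) (H : Scheme.{0})
      (ι : H ⟶ (Literature.AlgebraicGeometry.Motives.projectiveSpace n k).left), IsClosedImmersion ι → IsIntegral H →
      (∀ y : (Literature.AlgebraicGeometry.Motives.projectiveSpace n k).left,
        ∃ U : (Literature.AlgebraicGeometry.Motives.projectiveSpace n k).left.affineOpens,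
          y ∈ (U : (Literature.AlgebraicGeometry.Motives.projectiveSpace n k).left.Opens) ∧ (ι.ker.ideal U).IsPrincipal) →
      n = 3 → ¬ Scheme.IsRegular H → ∀ (e : ℕ) (F : MvPolynomial (Fin (n + 1)) k), 3 ≤ e → F.IsHomogeneous e → Prime F →
      (letI := MvPolynomial.gradedAlgebra (σ := Fin (n + 1)) (R := k)
       Set.range ι = {x : Proj (homogeneousSubmodule (Fin (n + 1)) k) | F ∈ x.asHomogeneousIdeal}) →
      ELNatConclusionO k n H ι) :
    Summit.ResolutionOfSingularities.ResolutionOfSingularities.Theses.EquisingularLift.EquisingularLiftNatThree := by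
  refine RouteCurrency.equisingularLiftNatThree_of_forall_elnatO_primeForms ?_
  intro p hp k _ _ _ n H ι hι hH hloc hn hreg e F he hF hprime hrange
  by_cases he3 : 3 ≤ e
  · exact h p hp k n H ι hι hH hloc hn hreg e F he3 hF hprime hrange
  · have he2 : e = 2 := by omega
    subst he2
    subst hn
    exact elnatO_quadric (n := 2) p hp k ι hι hH F hF hprime hrange

end QuadricELNat

end Summit.ResolutionOfSingularities.ResolutionOfSingularities.Cruxes.EquisingularLiftNat.Sections

end
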